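import Literature.MathematicalPhysics.QuantumFieldTheory.Balaban1983to89.B9ThmDLocDiffMajorants
import Literature.MathematicalPhysics.QuantumFieldTheory.Balaban1983to89.B9Cor36GpCubeEntriesAtV
import Literature.MathematicalPhysics.QuantumFieldTheory.Balaban1983to89.B9GeoInputsMultiRateKLevelV1
import Literature.MathematicalPhysics.QuantumFieldTheory.Balaban1983to89.B9Thm39CinvAtCoverAbove

/-!
# `Balaban1983to89.B9ThmDAtDatum` — THEOREM D FOR THE RECORD'S LETTERS, FILE D6: AT THE (3.35) DATUM, FOR EVERY MEMBER ABOVE ONE THRESHOLD — M5.6's binder `hD`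
# DELIVERED in p33 FILE 10's rate-function shape `∀ a ≤ δ_D, conj b((η²η²)·M_{χ̃_□}(XY G′ − XY O_□)M_{1_{□⁺}}) ≺ κ_D·e^{−2δ_D·D_sep}·ℓ(a)⁴·e^{−a·d}`
# (sub-row G-B9-LETTERS, GAPS G-B9-05 CLOSED for the record's letters, file D6)

T. Bałaban, *Propagators for lattice gauge theories in a background field*, Commun. Math. Phys. **99** (1985) 389–434 [`Balaban1985BackgroundPropagators`, "[B9]"];
[4] = T. Bałaban, *Propagators and renormalization transformations for lattice gauge theories. II*, Commun. Math. Phys. **96** (1984) 223–250 [`Balaban1984PropagatorsII`];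
[2] of [B9] = T. Bałaban, *Regularity and decay of lattice Green's functions*, Commun. Math. Phys. **89** (1983) 571–597 [`Balaban1983RegularityDecay`].

statement-level skeleton of published theorems with citation tags; proofs where landed; nothing here is a claim about the Yang–Mills mass gap

THE PRINT (held `paper:balaban1985-cmp99-background-propagators`, journal page = PDF page + 388).  p. 412 l. 1–9 (the Theorem D paragraph inside the proof of Thm 3.9):
*«|(G′(U)²h²_{□₀}χ_{□₀} − G′_{□₀}(U)²h²_{□₀}χ_{□₀})(y, y′)| ≦ O(1)e^{−δ₀M}(L^jη)⁴e^{−δ₀d(y,y′)}»*, `D_sep = M/(2L²)` on the (2.46) scale of the record (M5.6).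
LABELLED DEVIATION (lead GO 15:21Z (b)): print obtains this from [2] Sect. 5 Thm (5.8) p. 594 by a second random-walk expansion; files D1–D5 obtain it from the
commutator identity `O² − O_□² = …[M_χ, Δ′_{a,□}]G′_□…` (D1), the (3.89) mechanism for the plateau cut-off `χ_□` (D3), the support gap `≥ M_h/2` (D4) and [4]'s
composition calculus (D5); the printed SHAPE of the conclusion is kept, with `e^{−δ₀M} ↦ e^{−2δ_D·D_sep}`.

WHAT THIS FILE PROVES (THEOREMS only; 0 `def`; 0 sorry).
* §1 ★★★ `thmD_at_datum` — ∃ thresholds `M_L, M₀, T₀, N₀`, smallness `a₁ > 0`, rate `δ_D > 0`, constant `κ_D ≥ 0` such that for every member above the thresholds with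
  `c_f = L^k`, every section `ιB` of `β`, every `U` with `Δ′_a(U; parSymY)` a unit, contractive `parSymY(U)` and the member letter's site majorant
  `conj b(η²G′(U)) ≺ Aℓ²e^{−δ_Gd}`, every bi-contractive gauge `u` and (3.35) datum `(A, Q, C, ξ, Λ)` on the cube `□` with `αΛ² ≤ a₁, 1/4`, and every rate
  `0 ≤ a ≤ δ_D`: M5.6's `hD □` with the majorant `κ_D·e^{−2δ_D·DsepT i}·ℓ(a)⁴·e^{−a·d(a,a″)}`.
* §2 ★★★ `thmD_cover_binders` — the same for a FAMILY of data over all cubes (E2-6's binders): `∀ a ≤ δ_D, ∀ □, hD □`.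

HONEST SCOPE.  `𝔸` a complete normed `ℂ`-algebra with `‖1‖ = 1`, real basis `b` (bound `M₂`); `A ≥ 0`, `δ_G > 0` are parameters (p33 FILE 9's); `IsUnit Δ′_a(U; parSymY)`,
the contractivity of `parSymY(U)` and the member letter's (3.42)₀ site majorant stay DISPLAYED (discharged at 𝔸 = M_N(ℂ), G ≤ U(N) by p33 FILES 9/10).  Count-neutral;
nothing continuum, nothing about OS axioms or the mass gap.  No `sorry`, no `axiom`, no `instance`, no `notation`.  NEW file.  Net new unproved facts: 0.
Seat `lit-balaban-p21` gen 35, 2026-08-28; `--supports stmt-QuantumFields-19200`.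
-/

noncomputable section

namespace Literature.MathematicalPhysics.QuantumFieldTheory.Balaban1983to89.B9ThmDAtDatum

open B6RandomWalk (HasMajorant BlockSupp hasMajorant_mono Triangle254 Ineq261 c1_nonneg)
open B9Thm34Ext (toB6)
open B9Ineq347 (ScaleTransfer)
open B6KLevelCensusIndexV1 (KIdx kGeo)
open B6Cover236MultiLevelBlocks (cubes)
open B6Cover236MultiLevelTorusBlocks (cubeIndT)
open B6Geom246MultiLevelBox (blkOf)
open B6Ineq2142KLevelV1 (β)
open B6GlobalChartV1 (PV boxEquiv)
open B9BackgroundsKLevelV1 (shiftsV1)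
open B9GeoNormsKLevelV1 (geo9K)
open B9Eq352DivFormLetters (conj)
open B9Eq39Adjoint (R fluct covD)
open B9Eq360DeltaPrimeAY (AfldY)
open B9Eq360DeltaPrimeACubeY (blkCubeY)
open B9CubeLettersOpsL0 (deltaPrimeACubeY GpCubeY)
open B9CubeLettersBondOpsL0 (BlkCubeY)
open B9CubeGeometryInputs (geoCK geoCK_dist_axioms RM1 N1 exists_h261_geoCK hST_geoCK)
open B9GeoLemma21KLevelV1 (one_le_Mh)
open B9Eq359CubeKernelsAtOne (Cq Cq_nonneg)
open B9Cor36CubeTwinsGeometry (Mh_eq_DsepT)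
open B9Cor36CubeCutoffs (SC NearC chiY locCfgY)
open B9Cor36GpCubeLocLetter (locLetterY)
open B9Cor36GpCubeExtAtV (GpVK gp_cube_at_locCfg)
open B9Cor36GpCubeEntriesAtV (gp_cube_entries_at_locCfg)
open B9Thm37CubeCoverCommutators (cutMulY)
open B9Thm37CubeCoverCommutatorSizes (four_le_P')
open B9Thm39CinvAtCover (chiBigT DsepT DsepT_nonneg)
open B9Thm39CinvAtCoverAbove (size_of_threshold)
open B9GeoInputsMultiRateKLevelV1 (geo_inputs3_geo9K scaleTransfer_len_sq_geo9K)
open B9ThmDCubePlateau (deltaPrimeAY_gauge_mul_cutMulY_chiY chiBigT_site_mul_chiY chiY_mul_cubeIndT_site)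
open B9ThmDCommutatorStep (hasMajorant_conj_commStep)
open B9ThmDCubeSideKernels (hasMajorant_conj_commStep_trans hasMajorant_commStep_mul_G hasMajorant_G_oneSubSq_G transInd_nonneg_le_one gapW_nonneg_le_one)
open B9ThmDLocDiffMajorants (transfer_commStep transfer_commStep_mul_G transfer_G_oneSubSq_G hasMajorant_locDiff_site exp_rate_mono)
open B9ThmDLocDiffAlgebra (smul_cutMulY_XY_sub_XY_cutMulY_restrictScalars)
open B4PartitionUnity22 (thetaProf D1 D2 D1_nonneg D2_nonneg contDiff_thetaProf hasCompactSupport_thetaProf)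
open Node00 (SiteY BlkY IBondY CfgY GaugeY SiteParY toKT parSymY gaugeY gSiteY conjY UboxY GpY XY deltaPrimeAY etaS parSymY_one)

variable {d ℓ : ℕ} {hd : 1 ≤ d + 1} {hL : Odd (ℓ + 1) ∧ 1 < ℓ + 1} {b₀ b₁ : ℝ}
variable {𝔸 : Type} [NormedRing 𝔸] [NormedAlgebra ℂ 𝔸] [CompleteSpace 𝔸] [NormOneClass 𝔸]
variable {ι : Type} [Fintype ι] [DecidableEq ι] (b : Module.Basis ι ℝ 𝔸)

/-! ## §1 ★★★ THEOREM D at the (3.35) datum, one cube, every member above one threshold -/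

set_option maxHeartbeats 1600000 in
/-- ★★★ **THEOREM D FOR THE RECORD'S LETTERS AT THE (3.35) DATUM** — M5.6's binder `hD □` (`B9Thm39CinvAtCoverLargeDefect.cinv_cover_large_defect`) in p33 FILE 10's
rate-function shape: for every member above one threshold with `c_f = L^k`, every section `ιB` of `β`, every `U` with `Δ′_a(U; parSymY)` a unit, contractive
`parSymY(U)` and `conj b(η²G′(U)) ≺ Aℓ²e^{−δ_Gd}` on the site carrier, every bi-contractive `u` and (3.35) datum on `□`, and every rate `0 ≤ a ≤ δ_D`:
`conj b((η²η²)·M_{χ̃_□}(XY(G′)(U) − XY(O_□)(U))M_{1_{□⁺}}) ≺ κ_D·e^{−2δ_D·D_sep}·ℓ(a)⁴·e^{−a·d(a,a″)}` on the block carrier — print's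
«≦ O(1)e^{−δ₀M}(L^jη)⁴e^{−δ₀d(y,y′)}». [cite: Balaban1985BackgroundPropagators, p.412 l.1–9, (3.97) p.412, Cor. 3.6 p.408, Thm 3.1 (3.42) p.397; Balaban1983RegularityDecay, Thm (5.8) p.594; Balaban1984PropagatorsII, (2.83) p.237, Lemma 2.1 p.234] -/
theorem thmD_at_datum [∀ i' : KIdx d ℓ hd hL b₀ b₁, Fintype (geo9K i').Site] [∀ i' : KIdx d ℓ hd hL b₀ b₁, DecidableEq (geo9K i').Site]
    (Rr : KIdx d ℓ hd hL b₀ b₁ → ℝ) (Hp : KIdx d ℓ hd hL b₀ b₁ → Prop) (hℓ : 1 ≤ ℓ) {M₂ : ℝ} (hM₂ : 0 ≤ M₂)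
    (hrepr : ∀ (v : 𝔸) (j : ι), |b.repr v j| ≤ M₂ * ‖v‖) {A δG : ℝ} (hA : 0 ≤ A) (hδG : 0 < δG) :
    ∃ ML M₀ T₀ : ℝ, ∃ N₀ : ℕ, ∃ a₁ : ℝ, 0 < a₁ ∧ ∃ δD κD : ℝ, 0 < δD ∧ 0 ≤ κD ∧
    ∀ (i : KIdx d ℓ hd hL b₀ b₁) (c : ↥(cubes (toKT i).D.toDomains)),
      ML ≤ (geo9K i).M → M₀ ≤ ((ℓ : ℝ) + 1) * (toKT i).Mh → N₀ + 1 ≤ (toKT i).R * ((ℓ + 1) * (toKT i).Mh) → T₀ ≤ RM1 i →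
      i.cf = (((ℓ + 1 : ℕ) : ℝ)) ^ i.k →
    ∀ (ιB : BlkY i → IBondY i), (∀ s, β i.hN i.D i.hk (ιB s) = s) →
    ∀ (U : CfgY 𝔸 i), IsUnit (deltaPrimeAY i (parSymY i) U) →
      (∀ z w : SiteY i, ‖(parSymY i U z w : 𝔸)‖ ≤ 1 ∧ ‖(((parSymY i U z w)⁻¹ : 𝔸ˣ) : 𝔸)‖ ≤ 1) →
      HasMajorant (g := toB6 (geo9K i) (Rr i) (Hp i)) (fun p : SiteY i × ι => ιB (blkOf i.D.toDomains p.1))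
        (conj b ((etaS i ^ 2) • (GpY i (parSymY i) U).restrictScalars ℝ))
        (fun a a' => A * (geo9K i).len a ^ 2 * Real.exp (-(δG * (geo9K i).dist a a'))) →
    ∀ (g : GaugeY 𝔸 i), (∀ x, ‖(g x : 𝔸)‖ ≤ 1 ∧ ‖(((g x)⁻¹ : 𝔸ˣ) : 𝔸)‖ ≤ 1) →
    ∀ (Af : AfldY 𝔸 i) (Q : Set (Site (PV d ℓ i.m i.K hd hL) 0)) (C ξ Λ : ℝ),
      0 ≤ C → 0 < ξ → 1 ≤ Λ → ξ ≤ 5 * (SC i c : ℝ) * (kGeo i).eta → LatticeNorms.scaleLen ((ℓ : ℝ) + 1) (kGeo i).eta (c.1.1 + 1) ≤ Λ * ξ →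
      (∀ x : Site (PV d ℓ i.m i.K hd hL) 0, NearC i c (35 * SC i c / 8 + 1) (boxEquiv i.hN x).1 → x ∈ Q) →
      (∀ (κ : Fin (d + 1)) (x : Site (PV d ℓ i.m i.K hd hL) 0), x ∈ Q → x.shift κ ∈ Q → gaugeY i g U κ x = fluct (kGeo i).eta Af κ x) →
      (∀ κ, ∀ x ∈ Q, ‖Af κ x‖ ≤ C * ξ⁻¹) →
      (∀ μ ν, ∀ x ∈ Q, ‖(((kGeo i).eta : ℂ)⁻¹) • covD (shiftsV1 (PV d ℓ i.m i.K hd hL)) (fun _ _ => (1 : 𝔸ˣ)) μ (Af ν) x‖ ≤ C * (ξ ^ 2)⁻¹) →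
      max C (C * (1 + D1 thetaProf)) * Λ ^ 2 ≤ a₁ → max C (C * (1 + D1 thetaProf)) * Λ ^ 2 ≤ 1 / 4 →
    ∀ a : ℝ, 0 ≤ a → a ≤ δD →
      HasMajorant (g := toB6 (geo9K i) (Rr i) (Hp i)) (fun p : BlkY i × ι => ιB p.1)
        (conj b ((etaS i ^ 2 * etaS i ^ 2) • ((cutMulY (𝔸 := 𝔸) (chiBigT i c)).restrictScalars ℝ *
          ((XY i (parSymY i) (GpY i (parSymY i)) U).restrictScalars ℝ -
            (XY i (parSymY i) (fun _ => locLetterY i c (parSymY i) g (chiY i c) (locCfgY i c (kGeo i).eta Af)) U).restrictScalars ℝ) *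
          (cutMulY (𝔸 := 𝔸) (cubeIndT i.D (one_le_Mh i) (four_le_P' i) c)).restrictScalars ℝ)))
        (fun a' a'' => κD * Real.exp (-(2 * δD * DsepT i)) * (geo9K i).len a' ^ 4 * Real.exp (-(a * (geo9K i).dist a' a''))) := by
  have h1A : ‖(1 : 𝔸)‖ ≤ 1 := norm_one.le
  have hD1 := D1_nonneg contDiff_thetaProf hasCompactSupport_thetaProf
  have hD2 := D2_nonneg contDiff_thetaProf hasCompactSupport_thetaProf
  have hSb : 0 ≤ ∑ j, ‖b j‖ := Finset.sum_nonneg fun _ _ => norm_nonneg _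
  have hMS : 0 ≤ M₂ * ∑ j, ‖b j‖ := mul_nonneg hM₂ hSb
  have hL1 : (1 : ℝ) ≤ (ℓ : ℝ) + 1 := by linarith [(Nat.cast_nonneg ℓ : (0 : ℝ) ≤ ℓ)]
  have hL4 : (0 : ℝ) ≤ ((ℓ : ℝ) + 1) ^ 4 := by positivity
  have hL2 : (0 : ℝ) ≤ ((ℓ : ℝ) + 1) ^ 2 := by positivity
  have hlog : 0 ≤ Real.log ((ℓ : ℝ) + 1) := Real.log_nonneg hL1
  -- the two cube packages (p33 7b-C and its base)
  obtain ⟨δe, Bf, M₀e, T₀e, N₀e, hδe, hBf, a₁e, ha₁e, HE⟩ := gp_cube_entries_at_locCfg b d ℓ hℓ M₂ hM₂ hrepr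
  obtain ⟨δx, BGx, M₀x, T₀x, N₀x, hδx, hBGx, a₁x, ha₁x, Bx, hBx, HX⟩ := gp_cube_at_locCfg b d ℓ hℓ M₂ hM₂ hrepr
  -- the cube-side rates and (2.61) over `geoCK`
  set a₀ : ℝ := 9 / 5000 with ha₀def
  have ha₀0 : 0 < a₀ := by rw [ha₀def]; norm_num
  have ha₀1 : a₀ ≤ 1 := by rw [ha₀def]; norm_num
  have hσ₁ : 0 < (1 - a₀) * δe := by rw [ha₀def]; positivity
  have hσ₂ : 0 < (1 - a₀) * (δe / 2) := by rw [ha₀def]; positivity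
  obtain ⟨dB₁, h261C₁⟩ := exists_h261_geoCK d ℓ hσ₁
  obtain ⟨dB₂, h261C₂⟩ := exists_h261_geoCK d ℓ hσ₂
  set ρ₁ : ℝ := (1 - 1 / 2) * ((1 - a₀) * δe) with hρ₁def
  set ρ₂ : ℝ := (1 - 1 / 2) * ((1 - a₀) * (δe / 2)) with hρ₂def
  have hρ₁ : 0 < ρ₁ := by rw [hρ₁def]; positivity
  have hρ₂ : 0 < ρ₂ := by rw [hρ₂def]; positivity
  have hρ₂ρ₁ : ρ₂ ≤ ρ₁ := by rw [hρ₂def, hρ₁def, ha₀def]; linarith only [hδe.le]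
  have hρ₁δ : ρ₁ ≤ δe := by rw [hρ₁def, ha₀def]; linarith only [hδe.le]
  have hρ₂δ2 : ρ₂ ≤ δe / 2 := by rw [hρ₂def, ha₀def]; linarith only [hδe.le]
  have hρ₂δ : ρ₂ ≤ δe := hρ₂ρ₁.trans hρ₁δ
  -- the common member-side rate and (2.61) / scale transfer over `geo9K`
  set r : ℝ := min ρ₂ δG with hrdef
  have hr : 0 < r := lt_min hρ₂ hδG
  have hrρ₂ : r ≤ ρ₂ := min_le_left _ _
  have hrG : r ≤ δG := min_le_right _ _
  have h₁ : 0 < 1 / 2 * ((1 - 1 / 2) * r) := by positivity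
  have h₂ : 0 < 1 / 2 * ((1 - 1 / 2) * ((1 - 1 / 2) * ((1 - 1 / 2) * r))) := by positivity
  obtain ⟨ML₀, hgeo⟩ := geo_inputs3_geo9K Rr Hp h₁ h₂ h₂ (by positivity) (by norm_num : (1 : ℝ) / 2 ≤ 1)
  have hε : 0 < 1 / 2 * r := by positivity
  -- the uniform constants
  set θR : ℝ := M₂ * (∑ j, ‖b j‖) * (((d : ℝ) + 1) * Bf * (D1 thetaProf / 2 + 3 * D2 thetaProf / 16) + 1 + Bf * 1 + (1 + Cq d * (1 / 4)) ^ 2 * Bf) with hθRdef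
  have hθR : 0 ≤ θR := by rw [hθRdef]; have := Cq_nonneg d; positivity
  set θ₂ : ℝ := θR * Bf * ((ℓ : ℝ) + 1) ^ 4 * B6.c1 dB₁ ((1 - a₀) * δe) (1 / 2) with hθ₂def
  have hθ₂ : 0 ≤ θ₂ := by rw [hθ₂def]; have := c1_nonneg dB₁ ((1 - a₀) * δe) (1 / 2); positivity
  set θ₃ : ℝ := Bf * (M₂ * ∑ j, ‖b j‖) * Bf * ((ℓ : ℝ) + 1) ^ 4 * B6.c1 dB₂ ((1 - a₀) * (δe / 2)) (1 / 2) with hθ₃def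
  have hθ₃ : 0 ≤ θ₃ := by rw [hθ₃def]; have := c1_nonneg dB₂ ((1 - a₀) * (δe / 2)) (1 / 2); positivity
  set d₁ : ℕ := B9RWSums347DefiniteFaces.exp261 (geo9K (d := d) (ℓ := ℓ) (hd := hd) (hL := hL) (b₀ := b₀) (b₁ := b₁)) ((1 - 1 / 2) * r) (1 / 2) with hd₁def
  set d₂ : ℕ := max (B9RWSums347DefiniteFaces.exp261 (geo9K (d := d) (ℓ := ℓ) (hd := hd) (hL := hL) (b₀ := b₀) (b₁ := b₁))
      ((1 - 1 / 2) * ((1 - 1 / 2) * ((1 - 1 / 2) * r))) (1 / 2))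
    (B9RWSums347DefiniteFaces.exp261 (geo9K (d := d) (ℓ := ℓ) (hd := hd) (hL := hL) (b₀ := b₀) (b₁ := b₁))
      ((1 - 1 / 2) * ((1 - 1 / 2) * ((1 - 1 / 2) * r))) (1 / 2)) with hd₂def
  have hc1a : 0 ≤ B6.c1 d₁ ((1 - 1 / 2) * r) (1 / 2) := c1_nonneg _ _ _
  have hc1b : 0 ≤ B6.c1 d₂ ((1 - 1 / 2) * ((1 - 1 / 2) * ((1 - 1 / 2) * r))) (1 / 2) := c1_nonneg _ _ _
  set κ₀ : ℝ := (M₂ * ∑ j, ‖b j‖) * (A * A * ((ℓ : ℝ) + 1) ^ 2 * B6.c1 d₁ ((1 - 1 / 2) * r) (1 / 2) * ((M₂ * ∑ j, ‖b j‖) ^ 2 * θR) * 1 *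
      B6.c1 d₂ ((1 - 1 / 2) * ((1 - 1 / 2) * ((1 - 1 / 2) * r))) (1 / 2) +
      A * ((M₂ * ∑ j, ‖b j‖) ^ 2 * θ₂) * ((ℓ : ℝ) + 1) ^ 2 * B6.c1 d₁ ((1 - 1 / 2) * r) (1 / 2)) + (M₂ * ∑ j, ‖b j‖) ^ 2 * θ₃ with hκ₀def
  have hκ₀ : 0 ≤ κ₀ := by rw [hκ₀def]; positivity
  refine ⟨max ML₀ (2 * Real.log ((ℓ : ℝ) + 1) / (1 / 2 * r)), max M₀e M₀x,
    max (max T₀e T₀x) (max (4 * Real.log ((ℓ : ℝ) + 1) / (9 / 5000 * δe)) (4 * Real.log ((ℓ : ℝ) + 1) / (9 / 5000 * (δe / 2)))),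
    max (max N₀e N₀x) (max (N1 d ℓ (9 / 5000 * ((1 - a₀) * δe))) (N1 d ℓ (9 / 5000 * ((1 - a₀) * (δe / 2))))),
    min a₁e a₁x, lt_min ha₁e ha₁x, (1 - 1 / 2) * ((1 - 1 / 2) * ((1 - 1 / 2) * ((1 - 1 / 2) * r))), (M₂ * ∑ j, ‖b j‖) ^ 2 * κ₀, by positivity,
    by positivity, ?_⟩
  intro i c hML hM hN hT hcf ιB hι U hU hpar hGm g hu Af Q C ξ Λ hC0 hξ hΛ hξS hΛξ hQ hgA hAf hdA hα₁ hα4 a ha0 ha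
  -- thresholds
  have hMLe : ML₀ ≤ (geo9K i).M := (le_max_left _ _).trans hML
  have hMG : 2 * Real.log ((ℓ : ℝ) + 1) / (1 / 2 * r) ≤ (geo9K i).M := (le_max_right _ _).trans hML
  have hMe : M₀e ≤ ((ℓ : ℝ) + 1) * (toKT i).Mh := (le_max_left _ _).trans hM
  have hMx : M₀x ≤ ((ℓ : ℝ) + 1) * (toKT i).Mh := (le_max_right _ _).trans hM
  have hTe : T₀e ≤ RM1 i := ((le_max_left _ _).trans (le_max_left _ _)).trans hT
  have hTx : T₀x ≤ RM1 i := ((le_max_right _ _).trans (le_max_left _ _)).trans hT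
  have hT₁ : 4 * Real.log ((ℓ : ℝ) + 1) / (9 / 5000 * δe) ≤ RM1 i := ((le_max_left _ _).trans (le_max_right _ _)).trans hT
  have hT₂ : 4 * Real.log ((ℓ : ℝ) + 1) / (9 / 5000 * (δe / 2)) ≤ RM1 i := ((le_max_right _ _).trans (le_max_right _ _)).trans hT
  have hNe : N₀e + 1 ≤ (toKT i).R * ((ℓ + 1) * (toKT i).Mh) := le_trans (Nat.succ_le_succ ((le_max_left _ _).trans (le_max_left _ _))) hN
  have hNx : N₀x + 1 ≤ (toKT i).R * ((ℓ + 1) * (toKT i).Mh) := le_trans (Nat.succ_le_succ ((le_max_right _ _).trans (le_max_left _ _))) hN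
  have hN₁ : N1 d ℓ (9 / 5000 * ((1 - a₀) * δe)) + 1 ≤ (toKT i).R * ((ℓ + 1) * (toKT i).Mh) :=
    le_trans (Nat.succ_le_succ ((le_max_left _ _).trans (le_max_right _ _))) hN
  have hN₂ : N1 d ℓ (9 / 5000 * ((1 - a₀) * (δe / 2))) + 1 ≤ (toKT i).R * ((ℓ + 1) * (toKT i).Mh) :=
    le_trans (Nat.succ_le_succ ((le_max_right _ _).trans (le_max_right _ _))) hN
  have hα₁0 : 0 ≤ max C (C * (1 + D1 thetaProf)) * Λ ^ 2 := mul_nonneg (le_max_of_le_left hC0) (sq_nonneg _)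
  have hetaS : etaS i = (kGeo i).eta := by
    show etaS i = |i.cf|⁻¹
    unfold etaS B6Prop22KLevelTorusCensusEta.nKT
    rw [hcf, abs_of_nonneg (by positivity)]
    push_cast
    rfl
  have hg : ∀ (z : SiteY i) (x : 𝔸), ‖R (gSiteY i g z) x‖ ≤ ‖x‖ ∧ ‖R (gSiteY i g z)⁻¹ x‖ ≤ ‖x‖ := fun z x =>
    ⟨B9Eq360Vprime.norm_R_le_of_unit _ _ (hu _), B9Eq360Vprime.norm_R_le_of_unit _ _ ⟨(hu _).2, by rw [inv_inv]; exact (hu _).1⟩⟩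
  -- the packages at this member / cube
  obtain ⟨hunit, hGV, hDk, -, hLG⟩ := HE i c (Rr i) (Hp i) hMe hNe hTe g U Af Q C ξ Λ hC0 hξ hΛ hξS hΛξ hQ hgA hAf hdA (hα₁.trans (min_le_left _ _)) hα4
  obtain ⟨-, -, -, ⟨-, -, hkF, hsF⟩, -, -⟩ := HX i c (Rr i) (Hp i) hMx hNx hTx g U Af Q C ξ Λ hC0 hξ hΛ hξS hΛξ hQ hgA hAf hdA (hα₁.trans (min_le_right _ _)) hα4
  obtain ⟨hdnnC, -, -, -⟩ := geoCK_dist_axioms i c (Rr i) (Hp i)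
  -- D3: the commutator step, then the uniform constant `θ_R`
  have hR₀ := hasMajorant_conj_commStep i c b hM₂ hrepr h1A (Rr i) (Hp i) (parSymY i) (fun z w => parSymY_one i z w) (locCfgY i c (kGeo i).eta Af) hunit hBf (Cq_nonneg d) hα₁0
    hkF hsF hGV (fun μ => hDk (Sum.inl μ)) (fun μ => hDk (Sum.inr μ)) hLG
  have hR : HasMajorant (g := toB6 (geoCK i c) (Rr i) (Hp i)) (fun p : SiteY i × ι => blkCubeY i c p.1)
      (conj b (((cutMulY (chiY i c) * deltaPrimeACubeY i c (parSymY i) (locCfgY i c (kGeo i).eta Af) -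
        deltaPrimeACubeY i c (parSymY i) (locCfgY i c (kGeo i).eta Af) * cutMulY (chiY i c)) *
        GpCubeY i c (parSymY i) (locCfgY i c (kGeo i).eta Af)).restrictScalars ℝ))
      (fun a a' => θR * Real.exp (-(δe * (geoCK i c).dist a a'))) := by
    refine hasMajorant_mono (g := toB6 (geoCK i c) (Rr i) (Hp i)) _ hR₀ fun a a' => mul_le_mul_of_nonneg_right ?_ (Real.exp_nonneg _)
    rw [hθRdef]
    set Cqd : ℝ := Cq d with hCqd
    set α₁ : ℝ := max C (C * (1 + D1 thetaProf)) * Λ ^ 2 with hα₁def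
    have hCq : 0 ≤ Cqd := Cq_nonneg d
    have h0 : 0 ≤ 1 + Cqd * α₁ := add_nonneg zero_le_one (mul_nonneg hCq hα₁0)
    have h1 : 1 + Cqd * α₁ ≤ 1 + Cqd * (1 / 4) := by have := mul_le_mul_of_nonneg_left hα4 hCq; linarith only [this]
    have hsq : (1 + Cqd * α₁) ^ 2 ≤ (1 + Cqd * (1 / 4)) ^ 2 := pow_le_pow_left₀ h0 h1 2
    have h3 : (1 + Cqd * α₁) ^ 2 * Bf ≤ (1 + Cqd * (1 / 4)) ^ 2 * Bf := mul_le_mul_of_nonneg_right hsq hBf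
    refine mul_le_mul_of_nonneg_left ?_ hMS
    linarith only [h3]
  -- D4: the three cube-side kernels
  obtain ⟨-, hSTC₁, -, -, -, -⟩ := hST_geoCK i c hδe hT₁ a₀ (le_of_eq ha₀def.symm)
  obtain ⟨-, hSTC₂, -, -, -, -⟩ := hST_geoCK i c (half_pos hδe) hT₂ a₀ (le_of_eq ha₀def.symm)
  have h261₁ : Ineq261 dB₁ (toB6 (geoCK i c) (Rr i) (Hp i)) ((1 - a₀) * δe) (1 / 2) := h261C₁ i c (Rr i) (Hp i) hN₁ _ (by norm_num) (by norm_num)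
  have h261₂ : Ineq261 dB₂ (toB6 (geoCK i c) (Rr i) (Hp i)) ((1 - a₀) * (δe / 2)) (1 / 2) :=
    h261C₂ i c (Rr i) (Hp i) hN₂ _ (by norm_num) (by norm_num)
  have hK₁ := hasMajorant_conj_commStep_trans i c b (Rr i) (Hp i) (parSymY i) (locCfgY i c (kGeo i).eta Af) hθR hR
  have hK₂ := hasMajorant_commStep_mul_G i c b (Rr i) (Hp i) (parSymY i) (locCfgY i c (kGeo i).eta Af) dB₁ hθR hBf hL4 (mul_pos ha₀0 hδe).le
    (by norm_num) (by norm_num) hσ₁.le hSTC₁ h261₁ hR hGV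
  have hK₃ := hasMajorant_G_oneSubSq_G i c b (Rr i) (Hp i) (parSymY i) (locCfgY i c (kGeo i).eta Af) hM₂ hrepr dB₂ hδe.le hBf hL4
    (mul_pos ha₀0 (half_pos hδe)).le (by norm_num) (by norm_num) hσ₂.le hSTC₂ h261₂ hGV
  -- D5 §2: the three transfers to the member's blocks
  have hS₁ := transfer_commStep i c b ιB hM₂ hrepr hι (Rr i) (Hp i) (Rr i) (Hp i) g hg _ hθR hδe.le hK₁
  have hS₂ := transfer_commStep_mul_G i c b ιB hM₂ hrepr hι (Rr i) (Hp i) (Rr i) (Hp i) g hg _ hθ₂ hρ₁.le hK₂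
  have hS₃ := transfer_G_oneSubSq_G i c b ιB hM₂ hrepr hι (Rr i) (Hp i) (Rr i) (Hp i) g hg _ hθ₃ hρ₂.le hK₃
  -- the gap factor and the common rate
  set Eg : ℝ := Real.exp (-(ρ₂ * (((toKT i).Mh : ℝ) / 4))) with hEgdef
  have hEg0 : 0 < Eg := Real.exp_pos _
  have hMh0 : (0 : ℝ) ≤ ((toKT i).Mh : ℝ) := by positivity
  have hEδ : Real.exp (-(δe * (((toKT i).Mh : ℝ) / 4))) ≤ Eg := exp_rate_mono hρ₂δ (by positivity)
  have hEρ₁ : Real.exp (-(ρ₁ * (((toKT i).Mh : ℝ) / 4))) ≤ Eg := exp_rate_mono hρ₂ρ₁ (by positivity)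
  have hEσ : Real.exp (-(δe / 2 * (((toKT i).Mh : ℝ) / 2))) ≤ Eg := by
    have e : δe / 2 * (((toKT i).Mh : ℝ) / 2) = δe * (((toKT i).Mh : ℝ) / 4) := by ring
    rw [e]; exact hEδ
  obtain ⟨htri, -, -, hdnn, h261a, h261b, -, -⟩ := hgeo i hMLe
  have hl9 : ∀ a, 0 ≤ (geo9K i).len a := fun a => (B6KLevelCensusIndexV1.len_pos i a).le
  have hS₁' := hasMajorant_mono (g := toB6 (geo9K i) (Rr i) (Hp i)) (fun p : SiteY i × ι => ιB (blkOf i.D.toDomains p.1))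
      (K' := fun a a' => (M₂ * ∑ j, ‖b j‖) ^ 2 * θR * Eg * Real.exp (-(r * (geo9K i).dist a a'))) hS₁ fun a a' => by
    have hd := hdnn a a'
    have h2 : Real.exp (-(δe / 2 * (geo9K i).dist a a')) ≤ Real.exp (-(r * (geo9K i).dist a a')) := exp_rate_mono (hrρ₂.trans hρ₂δ2) hd
    calc (M₂ * ∑ j, ‖b j‖) ^ 2 * (θR * Real.exp (-(δe * (((toKT i).Mh : ℝ) / 4))) * Real.exp (-(δe / 2 * (geo9K i).dist a a')))
        = (M₂ * ∑ j, ‖b j‖) ^ 2 * θR * (Real.exp (-(δe * (((toKT i).Mh : ℝ) / 4))) * Real.exp (-(δe / 2 * (geo9K i).dist a a'))) := by ring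
      _ ≤ (M₂ * ∑ j, ‖b j‖) ^ 2 * θR * (Eg * Real.exp (-(r * (geo9K i).dist a a'))) :=
          mul_le_mul_of_nonneg_left (mul_le_mul hEδ h2 (Real.exp_nonneg _) (Real.exp_nonneg _)) (by positivity)
      _ = _ := by ring
  have hS₂' := hasMajorant_mono (g := toB6 (geo9K i) (Rr i) (Hp i)) (fun p : SiteY i × ι => ιB (blkOf i.D.toDomains p.1))
      (K' := fun a a' => (M₂ * ∑ j, ‖b j‖) ^ 2 * θ₂ * Eg * (geo9K i).len a ^ 2 * Real.exp (-(r * (geo9K i).dist a a'))) hS₂ fun a a' => by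
    have hd := hdnn a a'
    have hρρ : ρ₂ = ρ₁ / 2 := by rw [hρ₂def, hρ₁def]; ring
    have h2 : Real.exp (-(ρ₁ / 2 * (geo9K i).dist a a')) ≤ Real.exp (-(r * (geo9K i).dist a a')) := exp_rate_mono (by linarith only [hrρ₂, hρρ]) hd
    have hl := hl9 a
    calc (M₂ * ∑ j, ‖b j‖) ^ 2 * (θR * Bf * ((ℓ : ℝ) + 1) ^ 4 * B6.c1 dB₁ ((1 - a₀) * δe) (1 / 2) * Real.exp (-(ρ₁ * (((toKT i).Mh : ℝ) / 4))) *
          (geo9K i).len a ^ 2 * Real.exp (-(ρ₁ / 2 * (geo9K i).dist a a')))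
        = (M₂ * ∑ j, ‖b j‖) ^ 2 * θ₂ * (geo9K i).len a ^ 2 * (Real.exp (-(ρ₁ * (((toKT i).Mh : ℝ) / 4))) * Real.exp (-(ρ₁ / 2 * (geo9K i).dist a a'))) := by
          rw [hθ₂def]; ring
      _ ≤ (M₂ * ∑ j, ‖b j‖) ^ 2 * θ₂ * (geo9K i).len a ^ 2 * (Eg * Real.exp (-(r * (geo9K i).dist a a'))) :=
          mul_le_mul_of_nonneg_left (mul_le_mul hEρ₁ h2 (Real.exp_nonneg _) (Real.exp_nonneg _)) (by positivity)
      _ = _ := by ring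
  have hS₃' := hasMajorant_mono (g := toB6 (geo9K i) (Rr i) (Hp i)) (fun p : SiteY i × ι => ιB (blkOf i.D.toDomains p.1))
      (K' := fun a a' => (M₂ * ∑ j, ‖b j‖) ^ 2 * θ₃ * Eg * (geo9K i).len a ^ 4 * Real.exp (-(r * (geo9K i).dist a a'))) hS₃ fun a a' => by
    have hd := hdnn a a'
    have h2 : Real.exp (-(ρ₂ * (geo9K i).dist a a')) ≤ Real.exp (-(r * (geo9K i).dist a a')) := exp_rate_mono hrρ₂ hd
    have hl := hl9 a
    calc (M₂ * ∑ j, ‖b j‖) ^ 2 * (Bf * (M₂ * ∑ j, ‖b j‖) * Bf * ((ℓ : ℝ) + 1) ^ 4 * B6.c1 dB₂ ((1 - a₀) * (δe / 2)) (1 / 2) *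
          Real.exp (-(δe / 2 * (((toKT i).Mh : ℝ) / 2))) * (geo9K i).len a ^ 4 * Real.exp (-(ρ₂ * (geo9K i).dist a a')))
        = (M₂ * ∑ j, ‖b j‖) ^ 2 * θ₃ * (geo9K i).len a ^ 4 * (Real.exp (-(δe / 2 * (((toKT i).Mh : ℝ) / 2))) * Real.exp (-(ρ₂ * (geo9K i).dist a a'))) := by
          rw [hθ₃def]; ring
      _ ≤ (M₂ * ∑ j, ‖b j‖) ^ 2 * θ₃ * (geo9K i).len a ^ 4 * (Eg * Real.exp (-(r * (geo9K i).dist a a'))) :=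
          mul_le_mul_of_nonneg_left (mul_le_mul hEσ h2 (Real.exp_nonneg _) (Real.exp_nonneg _)) (by positivity)
      _ = _ := by ring
  -- the member letter at the common rate, in the lattice unit `η`
  have hO : HasMajorant (g := toB6 (geo9K i) (Rr i) (Hp i)) (fun p : SiteY i × ι => ιB (blkOf i.D.toDomains p.1))
      (conj b (((kGeo i).eta ^ 2) • (GpY i (parSymY i) U).restrictScalars ℝ)) (fun a a' => A * (geo9K i).len a ^ 2 * Real.exp (-(r * (geo9K i).dist a a'))) := by
    rw [← hetaS]
    exact hasMajorant_mono (g := toB6 (geo9K i) (Rr i) (Hp i)) _ hGm fun a a' =>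
      mul_le_mul_of_nonneg_left (exp_rate_mono hrG (hdnn a a')) (mul_nonneg hA (pow_nonneg (hl9 a) 2))
  -- the scale transfer of `ℓ²` at the common rate (p. 398), above the threshold
  have hMG' : 2 * Real.log ((ℓ : ℝ) + 1) ≤ 1 / 2 * r * (2 * ((ℓ : ℝ) + 1) ^ 2 - 1) * (geo9K i).M := size_of_threshold hε (by positivity) hMG
  have hST := scaleTransfer_len_sq_geo9K i hε hMG'
  -- D5 §3 at this cube
  have hsite := hasMajorant_locDiff_site i c b ιB hM₂ hrepr (Rr i) (Hp i) g U (locCfgY i c (kGeo i).eta Af) (fun z => chiBigT i c (blkOf i.D.toDomains z))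
    (fun z => cubeIndT i.D (one_le_Mh i) (four_le_P' i) c (blkOf i.D.toDomains z))
    (fun z => (B9ThmDLocDiffMajorants.chiBigT_site_le_nearInd i c z).trans (B9ThmDCubeSideKernels.nearInd_nonneg_le_one i c _).2) ((kGeo i).eta ^ 2) hU hunit
    (deltaPrimeAY_gauge_mul_cutMulY_chiY i c g U (kGeo i).eta Af hQ hgA) (chiBigT_site_mul_chiY i c) (chiY_mul_cubeIndT_site i c)
    (A := A) (r := r) (αst := 1 / 2) (α' := 1 / 2) (CG := ((ℓ : ℝ) + 1) ^ 2) (κ₁ := (M₂ * ∑ j, ‖b j‖) ^ 2 * θR * Eg)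
    (κ₂ := (M₂ * ∑ j, ‖b j‖) ^ 2 * θ₂ * Eg) (κ₃ := (M₂ * ∑ j, ‖b j‖) ^ 2 * θ₃ * Eg) d₁ d₂ hA hL2 (by positivity) (by positivity) (by positivity) hr.le
    (by norm_num) (by norm_num) (by norm_num) (by norm_num) htri hdnn hST h261a h261b hO hS₁' hS₂' hS₃'
  -- the `Q′( · )Q′*` sandwich (FILE 3b) on D1 §3's word, and the final shape
  rw [smul_cutMulY_XY_sub_XY_cutMulY_restrictScalars i (parSymY i) U, hetaS]
  have hK0 : ∀ a' a'' : (geo9K i).Site, 0 ≤ ((M₂ * ∑ j, ‖b j‖) * (A * A * ((ℓ : ℝ) + 1) ^ 2 * B6.c1 d₁ ((1 - 1 / 2) * r) (1 / 2) *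
      ((M₂ * ∑ j, ‖b j‖) ^ 2 * θR * Eg) * 1 * B6.c1 d₂ ((1 - 1 / 2) * ((1 - 1 / 2) * ((1 - 1 / 2) * r))) (1 / 2) +
      A * ((M₂ * ∑ j, ‖b j‖) ^ 2 * θ₂ * Eg) * ((ℓ : ℝ) + 1) ^ 2 * B6.c1 d₁ ((1 - 1 / 2) * r) (1 / 2)) + (M₂ * ∑ j, ‖b j‖) ^ 2 * θ₃ * Eg) *
      (geo9K i).len a' ^ 4 * Real.exp (-((1 - 1 / 2) * ((1 - 1 / 2) * ((1 - 1 / 2) * ((1 - 1 / 2) * r))) * (geo9K i).dist a' a'')) := fun a' a'' => by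
    have := hl9 a'; positivity
  refine hasMajorant_mono (g := toB6 (geo9K i) (Rr i) (Hp i)) _
    (B9Thm39CinvSandwichQ.hasMajorant_conj_QpY_sandwich_QpsY i b ιB (parSymY i) U hpar hM₂ hrepr hK0 hsite) fun a' a'' => ?_
  -- `e^{−ρ₂M_h/4} ≤ e^{−2δ_D·D_sep}` and the rate `a ≤ δ_D`
  have hd := hdnn a' a''
  have hl4 : 0 ≤ (geo9K i).len a' ^ 4 := pow_nonneg (hl9 a') 4
  have hDsep := DsepT_nonneg i
  have hMh : ((toKT i).Mh : ℝ) = 2 * ((ℓ : ℝ) + 1) * DsepT i := Mh_eq_DsepT i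
  have hEg : Eg ≤ Real.exp (-(2 * ((1 - 1 / 2) * ((1 - 1 / 2) * ((1 - 1 / 2) * ((1 - 1 / 2) * r)))) * DsepT i)) := by
    rw [hEgdef, hMh]
    refine Real.exp_le_exp.mpr ?_
    have h1 : (1 - 1 / 2) * ((1 - 1 / 2) * ((1 - 1 / 2) * ((1 - 1 / 2) * r))) ≤ ρ₂ / 16 := by linarith only [hrρ₂]
    have h2 : (1 - 1 / 2) * ((1 - 1 / 2) * ((1 - 1 / 2) * ((1 - 1 / 2) * r))) * DsepT i ≤ ρ₂ / 16 * DsepT i := mul_le_mul_of_nonneg_right h1 hDsep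
    have h0 : 0 ≤ ρ₂ * DsepT i := mul_nonneg hρ₂.le hDsep
    have h3 : ρ₂ * DsepT i ≤ ρ₂ * DsepT i * ((ℓ : ℝ) + 1) := le_mul_of_one_le_right h0 hL1
    linarith only [h2, h3, h0]
  have hrate : Real.exp (-((1 - 1 / 2) * ((1 - 1 / 2) * ((1 - 1 / 2) * ((1 - 1 / 2) * r))) * (geo9K i).dist a' a'')) ≤ Real.exp (-(a * (geo9K i).dist a' a'')) :=
    exp_rate_mono ha hd
  have e : (M₂ * ∑ j, ‖b j‖) ^ 2 * (((M₂ * ∑ j, ‖b j‖) * (A * A * ((ℓ : ℝ) + 1) ^ 2 * B6.c1 d₁ ((1 - 1 / 2) * r) (1 / 2) *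
      ((M₂ * ∑ j, ‖b j‖) ^ 2 * θR * Eg) * 1 * B6.c1 d₂ ((1 - 1 / 2) * ((1 - 1 / 2) * ((1 - 1 / 2) * r))) (1 / 2) +
      A * ((M₂ * ∑ j, ‖b j‖) ^ 2 * θ₂ * Eg) * ((ℓ : ℝ) + 1) ^ 2 * B6.c1 d₁ ((1 - 1 / 2) * r) (1 / 2)) + (M₂ * ∑ j, ‖b j‖) ^ 2 * θ₃ * Eg) *
      (geo9K i).len a' ^ 4 * Real.exp (-((1 - 1 / 2) * ((1 - 1 / 2) * ((1 - 1 / 2) * ((1 - 1 / 2) * r))) * (geo9K i).dist a' a''))) =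
      (M₂ * ∑ j, ‖b j‖) ^ 2 * κ₀ * Eg * (geo9K i).len a' ^ 4 *
        Real.exp (-((1 - 1 / 2) * ((1 - 1 / 2) * ((1 - 1 / 2) * ((1 - 1 / 2) * r))) * (geo9K i).dist a' a'')) := by
    rw [hκ₀def]; ring
  rw [e]
  have hpre : 0 ≤ (M₂ * ∑ j, ‖b j‖) ^ 2 * κ₀ := by positivity
  calc (M₂ * ∑ j, ‖b j‖) ^ 2 * κ₀ * Eg * (geo9K i).len a' ^ 4 *
        Real.exp (-((1 - 1 / 2) * ((1 - 1 / 2) * ((1 - 1 / 2) * ((1 - 1 / 2) * r))) * (geo9K i).dist a' a''))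
      = (M₂ * ∑ j, ‖b j‖) ^ 2 * κ₀ * (Eg * ((geo9K i).len a' ^ 4 *
        Real.exp (-((1 - 1 / 2) * ((1 - 1 / 2) * ((1 - 1 / 2) * ((1 - 1 / 2) * r))) * (geo9K i).dist a' a'')))) := by ring
    _ ≤ (M₂ * ∑ j, ‖b j‖) ^ 2 * κ₀ * (Real.exp (-(2 * ((1 - 1 / 2) * ((1 - 1 / 2) * ((1 - 1 / 2) * ((1 - 1 / 2) * r)))) * DsepT i)) *
        ((geo9K i).len a' ^ 4 * Real.exp (-(a * (geo9K i).dist a' a'')))) :=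
        mul_le_mul_of_nonneg_left (mul_le_mul hEg (mul_le_mul_of_nonneg_left hrate hl4) (by positivity) (Real.exp_nonneg _)) hpre
    _ = _ := by ring

/-! ## §2 ★★★ The binder `hD` of M5.6 for a family of (3.35) data over the cube cover -/

/-- ★★★ **THEOREM D OVER THE CUBE COVER OF RECORD** — M5.6's `hD` for EVERY cube, from ONE family of per-cube (3.35) data (E2-6's binders: gauges `u_□`, fields
`A_□`, regions `Q_□`, sizes `C_□, ξ_□, Λ_□`), in p33 FILE 10's rate-function shape `∀ a, 0 ≤ a → a ≤ δ_D → ∀ □, conj b(…) ≺ κ_D·e^{−2δ_D·D_sep}·ℓ(a)⁴·e^{−a·d}`.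
[cite: Balaban1985BackgroundPropagators, p.412 l.1–9, (3.97) p.412, Thm 3.9 p.413, Cor. 3.6 p.408; Balaban1983RegularityDecay, Thm (5.8) p.594; Balaban1984PropagatorsII, (2.83) p.237] -/
theorem thmD_cover_binders [∀ i' : KIdx d ℓ hd hL b₀ b₁, Fintype (geo9K i').Site] [∀ i' : KIdx d ℓ hd hL b₀ b₁, DecidableEq (geo9K i').Site]
    (Rr : KIdx d ℓ hd hL b₀ b₁ → ℝ) (Hp : KIdx d ℓ hd hL b₀ b₁ → Prop) (hℓ : 1 ≤ ℓ) {M₂ : ℝ} (hM₂ : 0 ≤ M₂)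
    (hrepr : ∀ (v : 𝔸) (j : ι), |b.repr v j| ≤ M₂ * ‖v‖) {A δG : ℝ} (hA : 0 ≤ A) (hδG : 0 < δG) :
    ∃ ML M₀ T₀ : ℝ, ∃ N₀ : ℕ, ∃ a₁ : ℝ, 0 < a₁ ∧ ∃ δD κD : ℝ, 0 < δD ∧ 0 ≤ κD ∧
    ∀ (i : KIdx d ℓ hd hL b₀ b₁),
      ML ≤ (geo9K i).M → M₀ ≤ ((ℓ : ℝ) + 1) * (toKT i).Mh → N₀ + 1 ≤ (toKT i).R * ((ℓ + 1) * (toKT i).Mh) → T₀ ≤ RM1 i →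
      i.cf = (((ℓ + 1 : ℕ) : ℝ)) ^ i.k →
    ∀ (ιB : BlkY i → IBondY i), (∀ s, β i.hN i.D i.hk (ιB s) = s) →
    ∀ (U : CfgY 𝔸 i), IsUnit (deltaPrimeAY i (parSymY i) U) →
      (∀ z w : SiteY i, ‖(parSymY i U z w : 𝔸)‖ ≤ 1 ∧ ‖(((parSymY i U z w)⁻¹ : 𝔸ˣ) : 𝔸)‖ ≤ 1) →
      HasMajorant (g := toB6 (geo9K i) (Rr i) (Hp i)) (fun p : SiteY i × ι => ιB (blkOf i.D.toDomains p.1))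
        (conj b ((etaS i ^ 2) • (GpY i (parSymY i) U).restrictScalars ℝ))
        (fun a a' => A * (geo9K i).len a ^ 2 * Real.exp (-(δG * (geo9K i).dist a a'))) →
    ∀ (g : ↥(cubes (toKT i).D.toDomains) → GaugeY 𝔸 i), (∀ c x, ‖(g c x : 𝔸)‖ ≤ 1 ∧ ‖(((g c x)⁻¹ : 𝔸ˣ) : 𝔸)‖ ≤ 1) →
    ∀ (Af : ↥(cubes (toKT i).D.toDomains) → AfldY 𝔸 i) (Q : ↥(cubes (toKT i).D.toDomains) → Set (Site (PV d ℓ i.m i.K hd hL) 0))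
      (C ξ Λ : ↥(cubes (toKT i).D.toDomains) → ℝ),
      (∀ c, 0 ≤ C c) → (∀ c, 0 < ξ c) → (∀ c, 1 ≤ Λ c) → (∀ c, ξ c ≤ 5 * (SC i c : ℝ) * (kGeo i).eta) →
      (∀ c, LatticeNorms.scaleLen ((ℓ : ℝ) + 1) (kGeo i).eta (c.1.1 + 1) ≤ Λ c * ξ c) →
      (∀ c, ∀ x : Site (PV d ℓ i.m i.K hd hL) 0, NearC i c (35 * SC i c / 8 + 1) (boxEquiv i.hN x).1 → x ∈ Q c) →
      (∀ c, ∀ (κ : Fin (d + 1)) (x : Site (PV d ℓ i.m i.K hd hL) 0), x ∈ Q c → x.shift κ ∈ Q c → gaugeY i (g c) U κ x = fluct (kGeo i).eta (Af c) κ x) →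
      (∀ c, ∀ κ, ∀ x ∈ Q c, ‖Af c κ x‖ ≤ C c * (ξ c)⁻¹) →
      (∀ c, ∀ μ ν, ∀ x ∈ Q c, ‖(((kGeo i).eta : ℂ)⁻¹) • covD (shiftsV1 (PV d ℓ i.m i.K hd hL)) (fun _ _ => (1 : 𝔸ˣ)) μ (Af c ν) x‖ ≤ C c * (ξ c ^ 2)⁻¹) →
      (∀ c, max (C c) (C c * (1 + D1 thetaProf)) * Λ c ^ 2 ≤ a₁) → (∀ c, max (C c) (C c * (1 + D1 thetaProf)) * Λ c ^ 2 ≤ 1 / 4) →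
    ∀ a : ℝ, 0 ≤ a → a ≤ δD → ∀ c : ↥(cubes (toKT i).D.toDomains),
      HasMajorant (g := toB6 (geo9K i) (Rr i) (Hp i)) (fun p : BlkY i × ι => ιB p.1)
        (conj b ((etaS i ^ 2 * etaS i ^ 2) • ((cutMulY (𝔸 := 𝔸) (chiBigT i c)).restrictScalars ℝ *
          ((XY i (parSymY i) (GpY i (parSymY i)) U).restrictScalars ℝ -
            (XY i (parSymY i) (fun _ => locLetterY i c (parSymY i) (g c) (chiY i c) (locCfgY i c (kGeo i).eta (Af c))) U).restrictScalars ℝ) *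
          (cutMulY (𝔸 := 𝔸) (cubeIndT i.D (one_le_Mh i) (four_le_P' i) c)).restrictScalars ℝ)))
        (fun a' a'' => κD * Real.exp (-(2 * δD * DsepT i)) * (geo9K i).len a' ^ 4 * Real.exp (-(a * (geo9K i).dist a' a''))) := by
  obtain ⟨ML, M₀, T₀, N₀, a₁, ha₁, δD, κD, hδD, hκD, H⟩ := thmD_at_datum b Rr Hp hℓ hM₂ hrepr hA hδG
  refine ⟨ML, M₀, T₀, N₀, a₁, ha₁, δD, κD, hδD, hκD, ?_⟩
  intro i hML hM hN hT hcf ιB hι U hU hpar hGm g hu Af Q C ξ Λ hC0 hξ hΛ hξS hΛξ hQ hgA hAf hdA hα₁ hα4 a ha0 ha c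
  exact H i c hML hM hN hT hcf ιB hι U hU hpar hGm (g c) (hu c) (Af c) (Q c) (C c) (ξ c) (Λ c) (hC0 c) (hξ c) (hΛ c) (hξS c) (hΛξ c) (hQ c) (hgA c)
    (hAf c) (hdA c) (hα₁ c) (hα4 c) a ha0 ha

end Literature.MathematicalPhysics.QuantumFieldTheory.Balaban1983to89.B9ThmDAtDatum

end
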